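import Summits.Parity.BatemanHorn.Theses.AlmostPrimeZeros

/-!
# Line `smooth-rough-lattice-acquisition` — skeleton for the crux `AlmostPrimeZeros.SystemZeroRepulsion`

(crux item stmt-Parity-11291, rank 2 of route `route-Parity-AlmostPrimeZeros`; idea card
`Cruxes/SystemZeroRepulsion/Ideas/smooth-rough-lattice-acquisition.md` (ideator 2, round 1); triage TRIAGE-r1-1/2/3: pass,
with sharpenings answered below; planner `planner-cruxplan-stmt-Parity-11291-smooth-rough-lattice-0`, 2026-08-16.)

Crux (FIXED, by name): for every Bateman–Horn system `f = (f₁,…,f_k)` there is `C_f` with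
`T_f(x) := Σ_ρ ‖1 − ρ‖⁻² ≤ C_f` for all `x ≥ 2`, the sum over the roots `ρ` (with multiplicity) of the almost-prime polynomial
`S_x(z) = Σ_{0 ≤ n ≤ x} z^{s_f(n)}`, `s_f(n) = Σ_i Σ_{p^v ∥ f_i(n)} min(v,2)` (typed through `Int.toNat`/`Nat.factorization`).

## The idea, and what the planner's checks did to it

Split the capped statistic at a threshold `y`: `s_f = s♭ + s♯` (primes `≤ y` / primes `> y`). The SMOOTH side is a theorem:
in the card's PERIODIC regime `s♭` is periodic modulo `Q = ∏_{p ≤ y} p²`, so `S_x(z) = Σ_{a mod Q} z^{s♭(a)}·ClassSum(Q, a; z)`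
EXACTLY for `n ≥ m₀(f)`, and the smooth weights average to the exact local Euler factor `Q⁻¹Σ_a z^{s♭(a)} = ∏_{p≤y} E_p(z)` whose modulus
is `≍ (log y)^{k(Re z−1)}` (Mertens + `AZFG2020_tendsto_sum_sub_omega_div_holds`) — zeros `z_p` of the `E_p` and all (S4). The ROUGH
side carries the crux: the rough class sums must "acquire the Γ-lattice", i.e. obey the universal, `λ_f`-free law
`Σ_{n≤x} z^{s♯(n)} ≈ x·U^{k(z−1)} e^{−γk(z−1)} D^{z−1} Γ(z)^{−k}` (`U = log x/log y`, `D = ∏ deg f_i`).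

PLANNER'S CHECK no. 1 (main term): the universal law is only the LEADING term — already for `f = X`, `z = 2`:
`Σ_{n≤x} 2^{s♯(n)} = Σ_{d ≤ x, P⁻(d) > y, cube-free} ⌊x/d⌋ = e^{−γ}x(U + 1) + o(x)` (de Bruijn–Buchstab: `Σ_{n≤x, P⁻(n)>y} 1/n = e^{−γ}(U+1)+o(1)`),
so the triage repair "main term + ADDITIVE error `η_x·xU^{k(Re z−1)}`" is true only with `η_x ≍ 1/U` — far too coarse for any
resummation. Hence the law enters the skeleton only as a ONE-SIDED MAJORANT of the rough sum (S6, growth `e^{C|z−1|log(|z−1|+2)}` = the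
`e^{O(R log R)}` that Disproof v4 computed to be affordable, `e^{cR²}` being not), and the resummation runs on EQUIDISTRIBUTION of the rough
statistic over smooth classes (S5) instead of on an explicit main term.
PLANNER'S CHECK no. 2 (which regime): with the card's transfer threshold `y = e^{√log x}` (pure-sieve regime) the absolute coefficient
mass of the complex-weight sieve on `|z−1| ≤ 3 log log x =: 3L` is `e^{O_f(L³)}`, so S5 would be needed to precision `e^{−L⁴}`; but the
rough statistic DOES see smooth classes at relative size `≍ |z−1|·log(class modulus)/log x` (size coupling: in the class `n ≡ 0 (4)`,
`f = X`, the rough cofactor lives below `x/4`, and at `z = 2` the class sum is `e^{−γ}(x/4)(U + 1 − log 4/log y) + o(x)`) — `e^{−L⁴}` precision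
is FALSE. The repair is to make the smooth modulus polylogarithmic: `y := log log x`, `Q = ∏_{p ≤ log log x} p² ≤ (log x)^{2.2}`,
`log y = log log log x =: L₃`, `U := log x/L₃` (so `U·L₃ = log x`). Then the smooth weights' absolute mass is only
`L₃^{k(|z|−1)}e^{O(|z|)}`, i.e. a loss `e^{O(|z−1| log L₃)}` against the sharp `(log x)^{k(Re z−1)}`, and S7 shows that a mere power
saving `(log x)^{−δ}` in S5 pays for it, PROVIDED the disc majorant is asked with growth `e^{C|z−1|^{3/2}}` rather than
`e^{C|z−1|log(|z−1|+2)}` — which Jensen (S3) tolerates (any exponent `< 2` does). The periodic regime is exactly the card's "first lemma"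
regime (there with `y = √log x`); the pure-sieve regime is recorded in S4's docstring as not transferable by absolute resummation.

## Geometry of the reduction (Disproof v1–v4 four-regime docblock, made into stubs)

`T_f(x) = NEAR + FAR`, NEAR = roots with `‖1 − ρ‖ < L`, FAR = roots with `‖1 − ρ‖ ≥ L`, `L = log log x`.
* FAR (regime iv) is NOT treated as free (triage r1-3 flag: Disproof v4 "free by fundamental lemma + Rankin" vs card
  far-zone-hardy-ramanujan-along-f "open anatomy for deg ≥ 2"): it is S2 ∘ S1, with the anatomy input S1 = `FarMomentAlongSystem`
  stated VERBATIM as in `SketchIdeator2.lean`, so that it is ONE shared stub across lines.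
* NEAR (regimes i–iii: core disc, `z = −1`, middle annulus) follows by Jensen at centre `1` (S3) from ONE statement, the one-sided
  disc majorant `‖S_x(z)‖ ≤ A x (log x)^{k(Re z−1)} e^{C|z−1|^{3/2}}` on `|z − 1| ≤ 3L` (`DiscMajorant`, the conclusion of S7):
  `F_x := S_x·(log x)^{−k(z−1)}` has `F_x(1) = x + 1`, so Jensen gives `N₁(r) ≤ log A + C(er)^{3/2}` for `r ≤ L` AND a zero-free core
  `r < r₀(A,C)` (no tracking, no Rouché, no lower bounds off the real axis).
* `DiscMajorant` = S7(S4, S5, S6): smooth theorem × rough equidistribution × rough majorant.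

## THE LINE — 7 registered stubs, glued by `SystemZeroRepulsion_of` (kernel-checked, no `sorry` of its own)

* S1 `stub_farMoment` — `Σ_{n≤x} t^{s_f(n)} ≤ (x+1)e^{C t log log x}` for `1 ≤ t ≤ √log x` (parity-free anatomy; theorem for `k = 1`,
  `f` linear; OPEN for `Σ deg f_i ≥ 2` — Nair–Tenenbaum with explicit tilt dependence). SHARED with the far-zone card.
* S2 `stub_farZone_of_farMoment` — S1 ⇒ FAR `≤ C_f` (Jensen for a nonnegative-coefficient polynomial at centre 1; provable now, L).
* S3 `stub_nearZone_of_majorant` — `DiscMajorant` ⇒ NEAR `≤ C_f` (Jensen + dyadic summation; provable now, L).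
* S4 `stub_smoothPeriodicFactorisation` — the exact CRT factorisation of `S_x(z)` into rough class sums modulo `Q`, with the two
  Euler-product bounds the resummation consumes (THEOREM; provable now, L).
* S5 `stub_roughEquidistribution` — rough class sums `= (1/d)·(full rough sum) + O((x/d) U^{k(Re z−1)} e^{C|z−1|log(|z−1|+2)} (log x)^{−δ})`
  for SOME `δ > 0`, all `d ∣ Q` (CONJECTURE; Siegel–Walfisz-range and provable-now territory for `f = X`; open for `deg ≥ 2`).
* S6 `stub_roughMajorant` (HARDEST) — `‖Σ_{m₀≤n≤x} z^{s♯(n)}‖ ≤ A x U^{k(Re z−1)} e^{C|z−1|log(|z−1|+2)}` on `|z−1| ≤ 3L` (CONJECTURE: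
  at `z = −t` it is rough Chowla along `f`; this is where `irreducible` and `pairwise_not_associated` are load-bearing — for `(X,X)` or `X²`
  the rough statistic is even and S6 fails at `z = −1`; for `f = X` it is the Selberg–Delange law with explicit `R`-dependence = the route's
  rank-5 statement in rough form).
* S7 `stub_majorant_of_smooth_rough` — S4 ∧ S5 ∧ S6 ⇒ `DiscMajorant` (resummation + one-variable calculus
  `sup_r(αr log L₃ − βr^{3/2}) = O((log L₃)³) ≪ δL`; provable now, M).
* Glue proved here: `zoneSplit`, `zoneSum_nonneg`, `bounded_of_eventually_bounded` (the finitely many `2 ≤ x < x₀(f)` are absorbed —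
  Disproof `withoutXGeTwo_iff`), and `SystemZeroRepulsion_of : SystemZeroRepulsion`.

Net logical content: `SystemZeroRepulsion ⟸ S1 ∧ S5 ∧ S6` with S2, S3, S4, S7 provable now. Every stub is stated INLINE over route
vocabulary only (Mathlib + `Literature.NumberTheory.Sieve.IsBatemanHornSystem` + the crux's own spelling of `s_f`, `S_x`), so each registered
signature can be restated verbatim in a `Theorems/` file. Notation in docstrings: `L = log log x` (also the threshold `y`), `L₃ = log L`,
`U = log x/L₃`, `Q = ∏_{p ≤ L} p²`, `s♯_x(n) = Σ_i Σ_{p^v ∥ f_i(n), p > L} min(v,2)`,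
`ClassSum_x(m₀; d, a; z) = Σ_{m₀ ≤ n ≤ x, n ≡ a (d)} z^{s♯_x(n)}`, `R_x(m₀; z) = Σ_{m₀ ≤ n ≤ x} z^{s♯_x(n)}`.

## Disproof.lean (cdisprove v1–v4, read through its evidence notes — the file is not mounted on this hub) honoured

`not_uniformConstant` / `exists_system_T_two_gt` / `exists_system_root_near_one`: every constant (`C, A, δ, x₀, m₀, r₀`) is quantified
AFTER `(k, f)`; the zero-free core of S3 has radius `r₀(A_f, C_f)`, not uniform. `isBatemanHornSystem_empty`/`T_fin_zero`: `k = 0` makes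
every stub trivially true (checked stub by stub in the docstrings). `withoutXGeTwo_iff`: small `x` handled by `bounded_of_eventually_bounded`.
Regime docblock: (iv) = S1+S2 (kept as a stub, not assumed free), (iii) = `DiscMajorant` via S4–S7, (ii) `z = −1` inside S6, (i) core disc
from S3(b). No `_false_without_<H>` theorem exists for this crux; no `Theorems/SystemZeroRepulsion/Negative/` lemma has landed (nothing to
import or to avoid). `ledger negatives --problem Parity`: 3 GHL entries, none about zeros of `S_x`, rough sums or class sums.
-/

noncomputable section

namespace Summit.Parity.BatemanHorn.Cruxes.SystemZeroRepulsion.SmoothRoughLatticeAcquisition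

open scoped BigOperators Nat
open Summit.Parity.BatemanHorn.Theses.AlmostPrimeZeros

set_option linter.unusedVariables false

/-! ## S1 — `stub_farMoment`: the parity-free anatomy input (SHARED with card far-zone-hardy-ramanujan-along-f) -/

/-- **S1 `stub_farMoment`** (`FarMomentAlongSystem`, verbatim the signature of
`SketchIdeator2.FarMomentAlongSystem` — the parity-free anatomy input SHARED with card far-zone-hardy-ramanujan-along-f).
For every Bateman–Horn system: `Σ_{n ≤ x} t^{s_f(n)} ≤ (x+1)·exp(C t log log x)` for all `x ≥ 3` and all real tilts
`1 ≤ t ≤ √log x` (positive weights only). Used by S2 with `t = 1 + e·r ≤ √log x` (far-zone Jensen circles); it is the only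
stub of the line whose difficulty is anatomy (large prime factors beyond `x`) rather than parity or analysis.
Why plausibly true: `E_n[t^{s_f(n)}] ≈ ∏_{p ≤ x^{D₀}} (1 + (t−1)ω_f(p)/p + …) ≈ (D₀ log x)^{k(t−1)} e^{O(t)}`, i.e. the bound
holds with room `e^{−t log log x}`. THEOREM for `k = 1`, `f` linear (`#{n ≤ x : d ∣ n} ≤ x/d + 1`, so
`Σ t^{s(n)} ≤ 2x ∏_{p≤x}(1 + (t−1)/p + (t²−t)/p²) ≤ 2x (log x)^{t−1} e^{O(t)}`; triage r1-2/r1-3 checked the whole range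
`t ≤ √log x`). OPEN for `D₀ = Σ deg f_i ≥ 2` or `k ≥ 2`: divisors of `∏ f_i(n)` beyond `x` make the trivial remainder useless;
Nair–Tenenbaum / Henriot give the right order for FIXED `t` with constants not explicit in `t` (NairTenenbaum1998, Henriot2012
Thm 1/3). `k = 0`: `Σ 1 = x+1` ✓. Small `x` (`3 ≤ x ≤ 15`, `0 < log log x < 1`) are absorbed by `C = C_f`.
Size: M for linear `f`; OPEN-anatomy (parity-free) in general. Leans on: Nat.factorization API, Finset.prod over
`Nat.primesLE`, Mertens (`Literature.NumberTheory.LFunctions.Mertens.*`). -/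
theorem stub_farMoment :
    ∀ (k : ℕ) (f : Fin k → Polynomial ℤ), Literature.NumberTheory.Sieve.IsBatemanHornSystem f →
      ∃ C : ℝ, ∀ x : ℕ, 3 ≤ x → ∀ t : ℝ, 1 ≤ t → t ≤ Real.sqrt (Real.log (x : ℝ)) →
        (∑ n ∈ Finset.range (x + 1), (t : ℝ) ^ (∑ i, (((f i).eval (n : ℤ)).toNat.factorization.sum fun _ v => min v 2))) ≤
          ((x : ℝ) + 1) * Real.exp (C * t * Real.log (Real.log (x : ℝ))) := by
  sorry

/-! ## S2 — `stub_farZone_of_farMoment`: Jensen at centre 1 clears the far zone `‖1 − ρ‖ ≥ log log x` -/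

/-- **S2 `stub_farZone_of_farMoment`** — the far zone is harmless GIVEN S1: for every system there are `C, x₀` with
`Σ_{ρ : ‖1−ρ‖ ≥ log log x} ‖1−ρ‖⁻² ≤ C` for `x ≥ x₀` (roots of `S_x` with multiplicity).
Proof sketch (provable now): `S_x` has nonnegative integer coefficients and `S_x(1) = x+1`, so on `|z − 1| = R`,
`|S_x(z)| ≤ S_x(|z|) ≤ S_x(1+R)`. Jensen at centre `1` with radii `r < e·r` (tree:
`Literature.Analysis.Complex.sum_divisor_le_of_circleAverage_le`, Mathlib `MeromorphicOn.circleAverage_log_norm`;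
`Polynomial.eval` of `S_x` is entire and its divisor is the root multiset) gives
`N₁(r) := #{ρ : ‖1−ρ‖ ≤ r} ≤ log(S_x(1+er)/(x+1)) ≤ C_f (1 + e r) log log x` for `e·r ≤ √log x − 1` (S1 with `t = 1+er`),
and `N₁(r) ≤ deg S_x ≤ C_f log x` always (`s_f(n) ≤ Σ_i 2·log₂ f_i(n)`, `0 < f_i(n) ≤ c x^{deg f_i}`). Abel summation over the
multiset: `Σ_{‖1−ρ‖ ≥ L} ‖1−ρ‖⁻² ≤ 2∫_L^∞ N₁(r) r⁻³ dr ≤ 2∫_L^{r₁} C(1+er)L r⁻³ dr + C log x / r₁²` with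
`r₁ = (√log x − 1)/e`, i.e. `≤ 2C(e + 1/(2L)) + 2Ce² = O_f(1)` (the boundary term `−N₁(L⁻)/L²` is `≤ 0`). `k = 0`: no roots.
Size: L (Jensen for polynomials + Stieltjes/Abel bookkeeping on `Multiset`). -/
theorem stub_farZone_of_farMoment :
    (∀ (k : ℕ) (f : Fin k → Polynomial ℤ), Literature.NumberTheory.Sieve.IsBatemanHornSystem f →
      ∃ C : ℝ, ∀ x : ℕ, 3 ≤ x → ∀ t : ℝ, 1 ≤ t → t ≤ Real.sqrt (Real.log (x : ℝ)) →
        (∑ n ∈ Finset.range (x + 1), (t : ℝ) ^ (∑ i, (((f i).eval (n : ℤ)).toNat.factorization.sum fun _ v => min v 2))) ≤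
          ((x : ℝ) + 1) * Real.exp (C * t * Real.log (Real.log (x : ℝ)))) →
    ∀ (k : ℕ) (f : Fin k → Polynomial ℤ), Literature.NumberTheory.Sieve.IsBatemanHornSystem f →
      ∃ C : ℝ, ∃ x₀ : ℕ, ∀ x : ℕ, x₀ ≤ x →
        ((((∑ n ∈ Finset.range (x + 1), (Polynomial.X : Polynomial ℂ) ^ (∑ i, (((f i).eval (n : ℤ)).toNat.factorization.sum fun _ v => min v 2)))).roots.filter (fun ρ : ℂ => Real.log (Real.log (x : ℝ)) ≤ ‖(1 : ℂ) - ρ‖)).map (fun ρ : ℂ => (‖(1 : ℂ) - ρ‖ ^ 2)⁻¹)).sum ≤ C := by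
  sorry

/-! ## S3 — `stub_nearZone_of_majorant`: Jensen at centre 1 turns the disc majorant into the near-zone bound -/

/-- **S3 `stub_nearZone_of_majorant`** — the near zone from the ONE-SIDED disc majorant (Disproof regime (iii) in Jensen form):
if for every system `‖S_x(z)‖ ≤ A·x·(log x)^{k(Re z−1)}·e^{C|z−1|^{3/2}}` on `|z − 1| ≤ 3 log log x` (`x ≥ x₀`), then
`Σ_{ρ : ‖1−ρ‖ < log log x} ‖1−ρ‖⁻² ≤ C'_f` for `x ≥ x₀'`. (Any growth `e^{C|z−1|^θ}` with `θ < 2` would do; the Hadamard bound that the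
crux itself returns, `e^{½C_f|z−1|²}`, would NOT — `θ = 3/2` is what S7 delivers.)
Proof sketch (provable now, no tracking / Rouché / lower bounds off the axis): put `F_x(z) := S_x(z)·exp(−k(z−1)·log log x)`
(entire, same zeros as `S_x` with the same multiplicities, `|exp(−k(z−1) log log x)| = (log x)^{−k(Re z−1)}`, `F_x(1) = x+1 ≥ x`).
Jensen at centre `1`, radius `R ≤ 3L` (`L = log log x`; tree: `Literature.Analysis.Complex.sum_divisor_le_of_circleAverage_le`):
`N₁(r)·log(R/r) ≤ log max_{|z−1|=R}|F_x| − log F_x(1) ≤ log A + C R^{3/2}`, where `N₁(r) = #{ρ : ‖1−ρ‖ ≤ r}` with multiplicity.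
(a) `R = e·r` (`r ≤ L`, so `R < 3L`): `N₁(r) ≤ g(r) := log A + C e^{3/2} r^{3/2}`. (b) `R = 1`: `N₁(r) < 1`, i.e. NO root, once
`log(1/r) > log A + C`: zero-free core `‖1−ρ‖ ≥ r₀ := exp(−(log A + C + 1)) > 0` — it depends on `f` through `A, C`, consistent with
Disproof `exists_system_root_near_one`. (c) dyadic shells `2^j r₀ ≤ ‖1−ρ‖ < 2^{j+1} r₀` (`2^{j+1}r₀ ≤ 2L`):
`Σ_{r₀ ≤ ‖1−ρ‖ < L} ‖1−ρ‖⁻² ≤ Σ_j g(2^{j+1} r₀)·(2^j r₀)⁻² ≤ Σ_j (log A·4^{−j}r₀⁻² + C'2^{−j/2} r₀^{−1/2}) < ∞`. Needs `Polynomial.eval` of the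
crux's sum (`eval_finset_sum`, `eval_pow`, `eval_X`) and root multiplicity = analytic order of `eval` (`Polynomial.roots`,
`MeromorphicOn.divisor`). `k = 0`: no roots. Size: L. -/
theorem stub_nearZone_of_majorant :
    (∀ (k : ℕ) (f : Fin k → Polynomial ℤ), Literature.NumberTheory.Sieve.IsBatemanHornSystem f →
      ∃ A C : ℝ, ∃ x₀ : ℕ, ∀ x : ℕ, x₀ ≤ x → ∀ z : ℂ, ‖z - 1‖ ≤ 3 * Real.log (Real.log (x : ℝ)) →
        ‖(∑ n ∈ Finset.range (x + 1), (z : ℂ) ^ (∑ i, (((f i).eval (n : ℤ)).toNat.factorization.sum fun _ v => min v 2)))‖ ≤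
          A * (x : ℝ) * (Real.log (x : ℝ)) ^ ((k : ℝ) * ((z : ℂ).re - 1)) * Real.exp (C * ‖(z : ℂ) - 1‖ ^ (3 / 2 : ℝ))) →
    ∀ (k : ℕ) (f : Fin k → Polynomial ℤ), Literature.NumberTheory.Sieve.IsBatemanHornSystem f →
      ∃ C : ℝ, ∃ x₀ : ℕ, ∀ x : ℕ, x₀ ≤ x →
        ((((∑ n ∈ Finset.range (x + 1), (Polynomial.X : Polynomial ℂ) ^ (∑ i, (((f i).eval (n : ℤ)).toNat.factorization.sum fun _ v => min v 2)))).roots.filter (fun ρ : ℂ => ‖(1 : ℂ) - ρ‖ < Real.log (Real.log (x : ℝ)))).map (fun ρ : ℂ => (‖(1 : ℂ) - ρ‖ ^ 2)⁻¹)).sum ≤ C := by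
  sorry

/-! ## S4 — `stub_smoothPeriodicFactorisation`: exact CRT factorisation of the smooth weights + local Euler-product bounds (the smooth THEOREM) -/

/-- **S4 `stub_smoothPeriodicFactorisation`** — THE SMOOTH THEOREM, periodic regime (the card's own "first lemma" regime,
with the threshold lowered from `√log x` to `y := log log x` so that the smooth modulus is polylogarithmic). Notation:
`L = log log x` (= `y`), `Q = ∏_{p ≤ y} p² ≤ e^{2.2 L} = (log x)^{2.2}`, `log y = log log log x =: L₃`, `U := log x / L₃`
(so `U·L₃ = log x`), `s♯_x(n)` = the capped statistic over primes `p > y`, `ClassSum_x(m₀; d, a; z) = Σ_{m₀≤n≤x, n≡a (d)} z^{s♯_x(n)}`.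
CLAIM: for every system there are `m₀` (beyond the finitely many `n` with some `f_i(n) ≤ 0`), `A, C, x₀` such that for `x ≥ x₀`,
`|z − 1| ≤ 3L`, there is a finite family `ι` of pairs `q = (d, a)` (`0 < d ∣ Q`) with coefficients `c_q ∈ ℂ` satisfying
 (E) `‖S_x(z) − Σ_q c_q·ClassSum_x(m₀; d, a; z)‖ ≤ x (log x)^{k(Re z−1)}`;
 (Λ) `‖Σ_q c_q/d‖ ≤ A·L₃^{k(Re z−1)}·e^{C|z−1| log(|z−1|+2)}`;
 (B) `Σ_q ‖c_q‖/d ≤ L₃^{k(|z|−1)}·e^{C(|z|+1)}`.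
Proof (provable now): take `ι = {(Q, a) : a < Q}`, `c_{(Q,a)} = z^{π(a)}` where `π(a) = Σ_i Σ_{p≤y} min(v_p(f_i(a')),2)` is the
smooth pattern of the class (`a' ≡ a (Q)`, `a' ≥ m₀`): for `n ≥ m₀` every `f_i(n) ≥ 1`, `toNat` is faithful and `min(v_p(f_i(n)),2)`
depends only on `n mod p²`, so `s_f(n) = π(n mod Q) + s♯_x(n)` EXACTLY (CRT) and `Σ_{m₀≤n≤x} z^{s_f(n)} = Σ_a z^{π(a)} ClassSum(Q,a)`;
(E) is then `|Σ_{n<m₀} z^{s_f(n)}| ≤ m₀ (3L+2)^{max_{n<m₀} s_f(n)} ≤ x(log x)^{k(Re z−1)}` (`≥ x e^{−k(3L+1)L}`) for large `x`.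
(Λ): `Q⁻¹Σ_{a mod Q} z^{π(a)} = ∏_{p≤y} E_p(z)` (CRT), `E_p(z) := p⁻²Σ_{a mod p²} z^{π_p(a)} = 1 + ω_f(p)(z−1)/p + ω_f(p)z(z−1)/p²` for
`p ∤ ∏Res(f_i,f_j)·∏disc f_i`; write `∏E_p(z) = λ_{f,y}(z)·∏_{p≤y}(1−1/p)^{−k(z−1)}` with `λ_{f,y}(z) = ∏_{p≤y}E_p(z)(1−1/p)^{k(z−1)}`:
`|∏_{p≤y}(1−1/p)^{−k(z−1)}| = M_y^{−k(Re z−1)} ≤ (log y)^{k(Re z−1)} 2^{k|z−1|}` (`1/(2 log y) ≤ M_y := ∏_{p≤y}(1−1/p) ≤ 2/log y`, Mertens)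
and `|λ_{f,y}(z)| ≤ e^{C_f(|z|+2) log log(|z|+4)}` for EVERY `y` (factors with `p > (|z|+2)²` are `1 + (ω_f(p)−k)(z−1)/p + O_f(|z|²/p²)` and
`sup_t |Σ_{p≤t}(ω_f(p) − k)/p| < ∞` is `Literature.NumberTheory.Sieve.AZFG2020_tendsto_sum_sub_omega_div_holds`; factors with `p ≤ (|z|+2)²`
cost `∏_{p≤|z|} 3kD₀|z|²/p² · e^{2k|z−1|Σ 1/p} = e^{O(|z|/log|z|) + O(|z| log log |z|)}`). (B): `Q⁻¹Σ_a |z|^{π(a)} = ∏_{p≤y}E_p(|z|)`; for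
`t = |z| ≤ 1`, `E_p(t) ≤ exp(−(1−t)ω_f(p)/p)` gives `≤ (log y)^{−k(1−t)} e^{O_f(1)}`; for `1 ≤ t`: primes `p ≤ min(t,y)` give
`∏ 3kD₀t²/p² = e^{π(·)(2 log t + O(1)) − 2θ(·)} ≤ e^{O(t)}` (here `t ≤ 3y+1`), primes `t < p ≤ y` give `exp((t−1)k(log log y − log log t) + O(t))`;
total `≤ (log y)^{k(t−1)} e^{C_f(t+1)}`. `k = 0`: `c ≡ 1`, (Λ) and (B) read `1 ≤ A`, `1 ≤ e^{C(|z|+1)}` ✓.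
WHY NOT the card's pure-sieve regime `y = e^{√log x}` (planner's check no. 2): there the absolute coefficient mass (B) is `e^{O_f(L³)}`, so the
rough class law would be needed to precision `e^{−L⁴}`, but the rough statistic DOES see smooth classes at relative size `≍ |z−1| log(d)/log x`
(size coupling: in the class `n ≡ 0 (4)`, `f = X`, the rough cofactor lives below `x/4`; at `z = 2` the class sum is `e^{−γ}(x/4)(u + 1 − log 4/log y)`,
off by `(x/4)·O(1/√log x) ≫ (x/4)u e^{−L⁴}`) — so that transfer is FALSE as a statement; with `y = log log x` the mass (B) is only
`e^{O(|z−1| log L₃)}` and a power saving `(log x)^{−δ}` in S5 suffices (S7). Size: L (CRT for the capped valuations of polynomial values,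
Euler-product bounds). Leans on: `Nat.ModEq`, `Nat.chineseRemainder`/`ZMod.chineseRemainder`, `Nat.primesLE`, `Nat.factorization`,
`Literature.NumberTheory.Sieve.polyRootCountMod`, `…AZFG2020_tendsto_sum_sub_omega_div_holds`, Mertens/Chebyshev bounds in the tree
(`Literature.NumberTheory.LFunctions.Mertens…`, `MertensConstant`). -/
theorem stub_smoothPeriodicFactorisation :
    ∀ (k : ℕ) (f : Fin k → Polynomial ℤ), Literature.NumberTheory.Sieve.IsBatemanHornSystem f →
      ∃ m₀ : ℕ, ∃ A C : ℝ, ∃ x₀ : ℕ, ∀ x : ℕ, x₀ ≤ x → ∀ z : ℂ, ‖z - 1‖ ≤ 3 * Real.log (Real.log (x : ℝ)) →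
        ∃ (ι : Finset (ℕ × ℕ)) (c : ℕ × ℕ → ℂ),
          (∀ q ∈ ι, 0 < q.1 ∧ q.1 ∣ (∏ p ∈ Nat.primesLE ⌊Real.log (Real.log (x : ℝ))⌋₊, p ^ 2)) ∧
          ‖(∑ n ∈ Finset.range (x + 1), (z : ℂ) ^ (∑ i, (((f i).eval (n : ℤ)).toNat.factorization.sum fun _ v => min v 2))) -
              ∑ q ∈ ι, c q * (∑ n ∈ (Finset.Ico m₀ (x + 1)).filter (fun n : ℕ => n ≡ q.2 [MOD q.1]), (z : ℂ) ^ (∑ i, (((f i).eval (n : ℤ)).toNat.factorization.sum fun p v => if Real.log (Real.log (x : ℝ)) < (p : ℝ) then min v 2 else 0)))‖ ≤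
            (x : ℝ) * (Real.log (x : ℝ)) ^ ((k : ℝ) * (z.re - 1)) ∧
          ‖∑ q ∈ ι, c q / (q.1 : ℂ)‖ ≤
            A * (Real.log (Real.log (Real.log (x : ℝ)))) ^ ((k : ℝ) * (z.re - 1)) * Real.exp (C * ‖(z : ℂ) - 1‖ * Real.log (‖(z : ℂ) - 1‖ + 2)) ∧
          ∑ q ∈ ι, ‖c q‖ / (q.1 : ℝ) ≤
            (Real.log (Real.log (Real.log (x : ℝ)))) ^ ((k : ℝ) * (‖z‖ - 1)) * Real.exp (C * (‖z‖ + 1)) := by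
  sorry

/-! ## S5 — `stub_roughEquidistribution` (transfer C⁺, part 1): the rough statistic does not see smooth residue classes -/

/-- **S5 `stub_roughEquidistribution`** (transfer `C⁺`, part 1 — CONJECTURE, power-saving form): the rough statistic is equidistributed
over the residue classes of the polylogarithmic smooth modulus. For every system and every `m₀` there are `δ > 0`, `C`, `x₀` such that for
`x ≥ x₀`, `|z − 1| ≤ 3 log log x`, every `0 < d ∣ Q = ∏_{p ≤ log log x} p²` and every `a`:
`‖ClassSum_x(m₀; d, a; z) − R_x(m₀; z)/d‖ ≤ (x/d)·U^{k(Re z−1)}·e^{C|z−1| log(|z−1|+2)}·(log x)^{−δ}`,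
`R_x(m₀; z) := Σ_{m₀ ≤ n ≤ x} z^{s♯_x(n)}`, `U = log x / log log log x`.
Why plausibly true (and why only a power saving is claimed): `d` is `y`-smooth and `s♯` involves only primes `q > y`, so the events
`q ∣ f_i(n)` are exactly equidistributed over `n mod d` on complete periods; what the class DOES change is the size of the rough cofactors
(the class fixes part of the smooth part of each `f_i(n)`, of size `≤ Q ≤ (log x)^{2.2}`), which shifts the universal law
`U^{k(z−1)}…Γ(z)^{−k}` by the relative amount `O(k|z−1| log Q / log x) = O(L²/log x)`; everything else is a square-root fluctuation
`√(x/d)·(log x)^{O(1)}` with `x/d ≥ x/Q = x^{1−o(1)}`. So the true error is `≍ (x/d)U^{k(Re z−1)}|profile(z)|·L²/log x`, and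
`|profile(z)| ≤ e^{O(|z−1| log(|z−1|+2))}` (Γ-growth): any `δ < 1` is plausible; S7 needs SOME `δ > 0`. Checks: `k = 0` (`s♯ ≡ 0`): both sides
count integers in `[m₀, x]`, difference `≤ 1` ✓; `z = 1`: difference `≤ 2` ✓; `f = X`, `d = 4`, `a = 0`, `z = 2`: `R_{x/4}(2) − R_x(2)/4 =
e^{−γ}(x/4)·O(1/log y)/…` = `(x/4)U·O(1/log x)` ✓ (this is the example that kills the `e^{−L⁴}`-precision version, see S4).
Status: for `k = 1`, `f` linear and `d ≤ Q ≤ (log x)^{2.2}` this is a Siegel–Walfisz-range statement for the TW-class multiplicative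
function `z^{s♯(n)}` (characters mod `d`, Selberg–Delange with `χ`: Tenenbaum2015 II.5–II.6, MontgomeryVaughan2007 §11 + Thm 7.18) —
provable-now territory, size L–XL; for `Σ deg f_i ≥ 2` it is OPEN (equidistribution of a parity-type statistic of polynomial values in APs
to polylog moduli; no known technique, but it is a DIFFERENCE statement, not a sign-pattern count). Load on hypotheses: none beyond the
system being fixed (constants after `f`, Disproof `not_uniformConstant`). -/
theorem stub_roughEquidistribution :
    ∀ (k : ℕ) (f : Fin k → Polynomial ℤ), Literature.NumberTheory.Sieve.IsBatemanHornSystem f →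
      ∀ m₀ : ℕ, ∃ δ : ℝ, 0 < δ ∧ ∃ C : ℝ, ∃ x₀ : ℕ, ∀ x : ℕ, x₀ ≤ x → ∀ z : ℂ, ‖z - 1‖ ≤ 3 * Real.log (Real.log (x : ℝ)) →
        ∀ d a : ℕ, 0 < d → d ∣ (∏ p ∈ Nat.primesLE ⌊Real.log (Real.log (x : ℝ))⌋₊, p ^ 2) →
          ‖(∑ n ∈ (Finset.Ico m₀ (x + 1)).filter (fun n : ℕ => n ≡ a [MOD d]), (z : ℂ) ^ (∑ i, (((f i).eval (n : ℤ)).toNat.factorization.sum fun p v => if Real.log (Real.log (x : ℝ)) < (p : ℝ) then min v 2 else 0))) -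
              (∑ n ∈ Finset.Ico m₀ (x + 1), (z : ℂ) ^ (∑ i, (((f i).eval (n : ℤ)).toNat.factorization.sum fun p v => if Real.log (Real.log (x : ℝ)) < (p : ℝ) then min v 2 else 0))) / (d : ℂ)‖ ≤
            (x : ℝ) / (d : ℝ) * (Real.log (x : ℝ) / Real.log (Real.log (Real.log (x : ℝ)))) ^ ((k : ℝ) * (z.re - 1)) * Real.exp (C * ‖(z : ℂ) - 1‖ * Real.log (‖(z : ℂ) - 1‖ + 2)) *
              (Real.log (x : ℝ)) ^ (-δ) := by
  sorry

/-! ## S6 — `stub_roughMajorant` (transfer C⁺, part 2 — HARDEST; "the rough count acquires the Γ-lattice", one-sided form) -/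

/-- **S6 `stub_roughMajorant`** (transfer `C⁺`, part 2 — the HARDEST stub; "the rough count acquires the Γ-lattice", one-sided).
For every system and every `m₀` there are `A, C, x₀` with
`‖R_x(m₀; z)‖ = ‖Σ_{m₀ ≤ n ≤ x} z^{s♯_x(n)}‖ ≤ A·x·U^{k(Re z−1)}·e^{C|z−1| log(|z−1|+2)}` for `x ≥ x₀`, `|z − 1| ≤ 3 log log x`
(`U = log x / log log log x`, `s♯_x` = capped count of prime factors `> y = log log x` of the `f_i(n)`).
Why plausibly true: the conjectured asymptotic (card; for `f = X`: Alladi1982, Tenenbaum2015 III.6, Hall–Tenenbaum Ch. 0) is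
`R_x(z) ≈ x·λ_f^{(>y)}(z)·U^{k(z−1)} e^{−γk(z−1)} D^{z−1} Γ(z)^{−k}·(1 + O_z(1/U))`, `D = ∏ deg f_i`, where
`λ_f^{(>y)}(z) = ∏_{p>y} E_p(z)(1−1/p)^{k(z−1)} → 1` locally uniformly as `x → ∞` (the limit law is UNIVERSAL, `λ_f`-free, and vanishes only on
the lattice `0, −1, −2, …`); at `|z| ≍ L` the factor `λ_f^{(>y)}` still carries the local zeros `z_p` of the `O(L/log L)` primes
`L < p ≤ 3L√(kD₀)` (all at distance `> L/√(kD₀)` from `1`), but a majorant does not see zeros and `|λ_f^{(>y)}(z)| ≤ e^{C_f(|z|+2) log log(|z|+4)}`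
(S4's bound, any `y`) stays inside the budget; `|Γ(z)^{−1}| ≤ e^{O((|z−1|+1)log(|z−1|+2))}` (tree: `Literature.Analysis.SpecialFunctions.GammaProductBounds`,
`GammaStirling*`), and the allowed growth `e^{C|z−1|log(|z−1|+2)}` is exactly the `R`-dependence `e^{O(R log R)}` that Disproof v4 computed to be
affordable (`e^{cR²}` would not be). A majorant tolerates the lower-order
terms that forbid pinning the main term (planner's check no. 1: `f = X`, `z = 2` gives `e^{−γ}x(U+1)`, not `e^{−γ}xU`). Content by direction:
`z = 1 + t`: sharp-exponent positive moment of the large-prime count (theorem for `f = X`: `≤ 2x∏_{y<p≤x}(1+(t−1)/p+(t²−t)/p²) ≤ 2xU^{t−1}e^{O(1)}`;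
anatomy for `deg ≥ 2`, cf. S1); `|z| = 1`: Erdős–Kac/Halász-type decay of `E_n e^{iθ s♯(n)}` along `f`; `z = −t`: ROUGH CHOWLA ALONG `f`,
`Σ_n (−t)^{s♯(n)} ≪ x U^{−k(1+t)} e^{O(t log t)}` — parity, confined to the primes `> log log x` (the smooth primes' share `(log y)^{−k(1+t)}`
is supplied unconditionally by S4 (Λ)), NOT removed (card, triage r1-1/2/3: "relocated"). Load-bearing hypotheses: `irreducible`,
`pairwise_not_associated` — for `(X, X)` or `X²` the rough statistic is even, `R(−1) = R(1) ≍ x` and S6 is false, matching the refuters'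
mutation analysis of the crux. For `k = 1`, `f = X`: `z^{s♯(n)}` is a TW-class multiplicative function and S6 is the Selberg–Delange law
with the `R`-dependence made explicit, `R = 3 log log x + 1` (MV2007 Thm 7.18 = `Literature.NumberTheory.LFunctions.MontgomeryVaughan2007_thm_7_18`
has `R` fixed; Disproof v4: "C(R) = e^{O(R log R)} suffices") — the rank-5 statement of the route in rough form; `k = 0`: `R = x+1−m₀ ≤ x` ✓.
Size: OPEN (parity-hard) for `deg ≥ 2` or `k ≥ 2`; L–XL for `f = X`. -/
theorem stub_roughMajorant :
    ∀ (k : ℕ) (f : Fin k → Polynomial ℤ), Literature.NumberTheory.Sieve.IsBatemanHornSystem f →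
      ∀ m₀ : ℕ, ∃ A C : ℝ, ∃ x₀ : ℕ, ∀ x : ℕ, x₀ ≤ x → ∀ z : ℂ, ‖z - 1‖ ≤ 3 * Real.log (Real.log (x : ℝ)) →
        ‖(∑ n ∈ Finset.Ico m₀ (x + 1), (z : ℂ) ^ (∑ i, (((f i).eval (n : ℤ)).toNat.factorization.sum fun p v => if Real.log (Real.log (x : ℝ)) < (p : ℝ) then min v 2 else 0)))‖ ≤
          A * (x : ℝ) * (Real.log (x : ℝ) / Real.log (Real.log (Real.log (x : ℝ)))) ^ ((k : ℝ) * (z.re - 1)) * Real.exp (C * ‖(z : ℂ) - 1‖ * Real.log (‖(z : ℂ) - 1‖ + 2)) := by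
  sorry

/-! ## S7 — `stub_majorant_of_smooth_rough`: resummation — smooth factorisation × rough equidistribution × rough majorant ⇒ disc majorant -/

/-- **S7 `stub_majorant_of_smooth_rough`** — the resummation (provable now): S4 ∧ S5 ∧ S6 ⇒ `DiscMajorant`
(`‖S_x(z)‖ ≤ A x (log x)^{k(Re z−1)} e^{C|z−1|^{3/2}}` on `|z−1| ≤ 3L`). Given `f`, take `m₀, A₄, C₄, x₀` from S4, then `δ, C₅, x₁` from
S5 at `m₀` and `A₆, C₆, x₂` from S6 at `m₀`. For `x` large and `r := |z−1| ≤ 3L`, with `a := k(Re z−1)`, `ℓ(r) := log(r+2)`: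
`‖S_x(z)‖ ≤ ‖Σ_q c_q ClassSum_q‖ + x(log x)^a`                                                        (E)
`≤ ‖R_x(m₀;z)‖·‖Σ_q c_q/d_q‖ + (Σ_q ‖c_q‖/d_q)·max_q d_q‖ClassSum_q − R/d_q‖ + x(log x)^a`             (triangle inequality over `ι`)
`≤ A₆xU^a e^{C₆rℓ} · A₄L₃^a e^{C₄rℓ} + L₃^{k(|z|−1)}e^{C₄(|z|+1)} · xU^a e^{C₅rℓ}(log x)^{−δ} + x(log x)^a`   (S6, Λ, B, S5).
Now `U^a L₃^a = (log x)^a` (`Real.mul_rpow`; `U·L₃ = log x`), `L₃^{k(|z|−1)} U^a = (log x)^a L₃^{k(|z|−Re z)} ≤ (log x)^a e^{2kr log⁺L₃}`, and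
`(log x)^{−δ} = e^{−δL}`; so the three terms are `≤ x(log x)^a` times `A₄A₆ e^{(C₄+C₆)rℓ}`, `e^{2kr log⁺L₃ + C₄(r+2) + C₅rℓ − δL}`, `1`. Finally
`rℓ(r) ≤ r^{3/2} + 2r + 1`, and ELEMENTARY CALCULUS: `sup_{r ≥ 0} (αr·log⁺L₃ − βr^{3/2}) = (4α³/27β²)(log⁺L₃)³`, so
`2kr log⁺L₃ + C₄(r+2) + C₅rℓ − δL − βr^{3/2} ≤ c(k,β,C₄,C₅)(1 + (log L₃)³) − δL ≤ c'` uniformly in `x` (as `(log log log log x)³ ≪ log log x`).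
Hence `‖S_x(z)‖ ≤ A x (log x)^a e^{C r^{3/2}}` with `C := C₄ + C₆ + β + 1`, `A := A₄A₆e^{c₀} + e^{c'} + 1`. `k = 0`: immediate. Size: M
(rpow algebra, `norm_sum_le`, `Finset.mul_sum`, one-variable calculus bound); no number theory. -/
theorem stub_majorant_of_smooth_rough :
    (∀ (k : ℕ) (f : Fin k → Polynomial ℤ), Literature.NumberTheory.Sieve.IsBatemanHornSystem f →
      ∃ m₀ : ℕ, ∃ A C : ℝ, ∃ x₀ : ℕ, ∀ x : ℕ, x₀ ≤ x → ∀ z : ℂ, ‖z - 1‖ ≤ 3 * Real.log (Real.log (x : ℝ)) →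
        ∃ (ι : Finset (ℕ × ℕ)) (c : ℕ × ℕ → ℂ),
          (∀ q ∈ ι, 0 < q.1 ∧ q.1 ∣ (∏ p ∈ Nat.primesLE ⌊Real.log (Real.log (x : ℝ))⌋₊, p ^ 2)) ∧
          ‖(∑ n ∈ Finset.range (x + 1), (z : ℂ) ^ (∑ i, (((f i).eval (n : ℤ)).toNat.factorization.sum fun _ v => min v 2))) -
              ∑ q ∈ ι, c q * (∑ n ∈ (Finset.Ico m₀ (x + 1)).filter (fun n : ℕ => n ≡ q.2 [MOD q.1]), (z : ℂ) ^ (∑ i, (((f i).eval (n : ℤ)).toNat.factorization.sum fun p v => if Real.log (Real.log (x : ℝ)) < (p : ℝ) then min v 2 else 0)))‖ ≤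
            (x : ℝ) * (Real.log (x : ℝ)) ^ ((k : ℝ) * (z.re - 1)) ∧
          ‖∑ q ∈ ι, c q / (q.1 : ℂ)‖ ≤
            A * (Real.log (Real.log (Real.log (x : ℝ)))) ^ ((k : ℝ) * (z.re - 1)) * Real.exp (C * ‖(z : ℂ) - 1‖ * Real.log (‖(z : ℂ) - 1‖ + 2)) ∧
          ∑ q ∈ ι, ‖c q‖ / (q.1 : ℝ) ≤
            (Real.log (Real.log (Real.log (x : ℝ)))) ^ ((k : ℝ) * (‖z‖ - 1)) * Real.exp (C * (‖z‖ + 1))) →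
    (∀ (k : ℕ) (f : Fin k → Polynomial ℤ), Literature.NumberTheory.Sieve.IsBatemanHornSystem f →
      ∀ m₀ : ℕ, ∃ δ : ℝ, 0 < δ ∧ ∃ C : ℝ, ∃ x₀ : ℕ, ∀ x : ℕ, x₀ ≤ x → ∀ z : ℂ, ‖z - 1‖ ≤ 3 * Real.log (Real.log (x : ℝ)) →
        ∀ d a : ℕ, 0 < d → d ∣ (∏ p ∈ Nat.primesLE ⌊Real.log (Real.log (x : ℝ))⌋₊, p ^ 2) →
          ‖(∑ n ∈ (Finset.Ico m₀ (x + 1)).filter (fun n : ℕ => n ≡ a [MOD d]), (z : ℂ) ^ (∑ i, (((f i).eval (n : ℤ)).toNat.factorization.sum fun p v => if Real.log (Real.log (x : ℝ)) < (p : ℝ) then min v 2 else 0))) -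
              (∑ n ∈ Finset.Ico m₀ (x + 1), (z : ℂ) ^ (∑ i, (((f i).eval (n : ℤ)).toNat.factorization.sum fun p v => if Real.log (Real.log (x : ℝ)) < (p : ℝ) then min v 2 else 0))) / (d : ℂ)‖ ≤
            (x : ℝ) / (d : ℝ) * (Real.log (x : ℝ) / Real.log (Real.log (Real.log (x : ℝ)))) ^ ((k : ℝ) * (z.re - 1)) * Real.exp (C * ‖(z : ℂ) - 1‖ * Real.log (‖(z : ℂ) - 1‖ + 2)) *
              (Real.log (x : ℝ)) ^ (-δ)) →
    (∀ (k : ℕ) (f : Fin k → Polynomial ℤ), Literature.NumberTheory.Sieve.IsBatemanHornSystem f →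
      ∀ m₀ : ℕ, ∃ A C : ℝ, ∃ x₀ : ℕ, ∀ x : ℕ, x₀ ≤ x → ∀ z : ℂ, ‖z - 1‖ ≤ 3 * Real.log (Real.log (x : ℝ)) →
        ‖(∑ n ∈ Finset.Ico m₀ (x + 1), (z : ℂ) ^ (∑ i, (((f i).eval (n : ℤ)).toNat.factorization.sum fun p v => if Real.log (Real.log (x : ℝ)) < (p : ℝ) then min v 2 else 0)))‖ ≤
          A * (x : ℝ) * (Real.log (x : ℝ) / Real.log (Real.log (Real.log (x : ℝ)))) ^ ((k : ℝ) * (z.re - 1)) * Real.exp (C * ‖(z : ℂ) - 1‖ * Real.log (‖(z : ℂ) - 1‖ + 2))) →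
    ∀ (k : ℕ) (f : Fin k → Polynomial ℤ), Literature.NumberTheory.Sieve.IsBatemanHornSystem f →
      ∃ A C : ℝ, ∃ x₀ : ℕ, ∀ x : ℕ, x₀ ≤ x → ∀ z : ℂ, ‖z - 1‖ ≤ 3 * Real.log (Real.log (x : ℝ)) →
        ‖(∑ n ∈ Finset.range (x + 1), (z : ℂ) ^ (∑ i, (((f i).eval (n : ℤ)).toNat.factorization.sum fun _ v => min v 2)))‖ ≤
          A * (x : ℝ) * (Real.log (x : ℝ)) ^ ((k : ℝ) * ((z : ℂ).re - 1)) * Real.exp (C * ‖(z : ℂ) - 1‖ ^ (3 / 2 : ℝ)) := by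
  sorry

/-! ## Glue (sorry-free): zone splitting, positivity, and `eventually ⇒ every x ≥ 2` -/

/-- A nonnegative sequence bounded from some point on is bounded everywhere (finitely many earlier values). -/
theorem bounded_of_eventually_bounded {T : ℕ → ℝ} (hT : ∀ x, 0 ≤ T x) {B : ℝ} {x₀ : ℕ}
    (h : ∀ x, x₀ ≤ x → T x ≤ B) : ∃ C : ℝ, ∀ x, T x ≤ C := by
  refine ⟨B + ∑ x ∈ Finset.range x₀, T x, fun x => ?_⟩
  have hB : 0 ≤ B := (hT x₀).trans (h x₀ le_rfl)
  have hS : 0 ≤ ∑ x ∈ Finset.range x₀, T x := Finset.sum_nonneg fun x _ => hT x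
  by_cases hx : x₀ ≤ x
  · exact (h x hx).trans (le_add_of_nonneg_right hS)
  · have hx' : x ∈ Finset.range x₀ := Finset.mem_range.2 (lt_of_not_ge hx)
    calc T x ≤ ∑ x ∈ Finset.range x₀, T x := Finset.single_le_sum (fun x _ => hT x) hx'
      _ ≤ B + ∑ x ∈ Finset.range x₀, T x := le_add_of_nonneg_left hB

/-- The zero functional of a root multiset splits into the near zone `‖1 − ρ‖ < R` and the far zone `R ≤ ‖1 − ρ‖`. -/
theorem zoneSplit (s : Multiset ℂ) (R : ℝ) :
    (s.map (fun ρ : ℂ => (‖(1 : ℂ) - ρ‖ ^ 2)⁻¹)).sum =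
      ((s.filter (fun ρ : ℂ => ‖(1 : ℂ) - ρ‖ < R)).map (fun ρ : ℂ => (‖(1 : ℂ) - ρ‖ ^ 2)⁻¹)).sum +
      ((s.filter (fun ρ : ℂ => R ≤ ‖(1 : ℂ) - ρ‖)).map (fun ρ : ℂ => (‖(1 : ℂ) - ρ‖ ^ 2)⁻¹)).sum := by
  conv_lhs => rw [← Multiset.filter_add_not (fun ρ : ℂ => ‖(1 : ℂ) - ρ‖ < R) s]
  rw [Multiset.map_add, Multiset.sum_add]
  congr 3
  exact Multiset.filter_congr fun ρ _ => not_lt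

/-- Each summand `(‖1 − ρ‖²)⁻¹` is nonnegative, hence so is every zone sum. -/
theorem zoneSum_nonneg (s : Multiset ℂ) : 0 ≤ (s.map (fun ρ : ℂ => (‖(1 : ℂ) - ρ‖ ^ 2)⁻¹)).sum := by
  refine Multiset.sum_nonneg fun t ht => ?_
  obtain ⟨ρ, -, rfl⟩ := Multiset.mem_map.1 ht
  positivity

/-- **`SystemZeroRepulsion` from the line `smooth-rough-lattice-acquisition`** (kernel-checked composition; no `sorry`
of its own — its axioms are the seven stubs'). `T_f(x) = [near zone] + [far zone]`; the near zone is bounded by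
S3 ∘ S7 ∘ (S4, S5, S6), the far zone by S2 ∘ S1, both from some `x₀(f)` on; the finitely many `2 ≤ x < x₀` are
absorbed into the constant (every `T_f(x)` is a finite nonnegative number — Disproof `withoutXGeTwo_iff`). -/
theorem SystemZeroRepulsion_of : SystemZeroRepulsion := by
  intro k f hf
  obtain ⟨C₁, x₁, h₁⟩ :=
    stub_nearZone_of_majorant
      (stub_majorant_of_smooth_rough stub_smoothPeriodicFactorisation stub_roughEquidistribution
        stub_roughMajorant)
      k f hf
  obtain ⟨C₂, x₂, h₂⟩ := stub_farZone_of_farMoment stub_farMoment k f hf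
  have hT0 : ∀ x : ℕ, 0 ≤ (((∑ n ∈ Finset.range (x + 1), (Polynomial.X : Polynomial ℂ) ^ (∑ i, (((f i).eval (n : ℤ)).toNat.factorization.sum fun _ v => min v 2)))).roots.map (fun ρ : ℂ => (‖(1 : ℂ) - ρ‖ ^ 2)⁻¹)).sum := fun x => zoneSum_nonneg _
  obtain ⟨C, hC⟩ := bounded_of_eventually_bounded hT0 (B := C₁ + C₂) (x₀ := max x₁ x₂) (fun x hx => by
    rw [zoneSplit _ (Real.log (Real.log (x : ℝ)))]
    exact add_le_add (h₁ x (le_of_max_le_left hx)) (h₂ x (le_of_max_le_right hx)))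
  exact ⟨C, fun x _ => hC x⟩

/-- Sanity: the composition really is the route's crux decl, by name. -/
example : Summit.Parity.BatemanHorn.Theses.AlmostPrimeZeros.SystemZeroRepulsion := SystemZeroRepulsion_of

end Summit.Parity.BatemanHorn.Cruxes.SystemZeroRepulsion.SmoothRoughLatticeAcquisition
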